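import Literature.Analysis.FluidPDE.AxisymmetricNoSwirlAprioriProofs
import Literature.Analysis.FluidPDE.LadyzhenskayaWeightedEstimateForced
import Literature.Analysis.FluidPDE.AxisymNoSwirlEnstrophyIneqForced
import Literature.Analysis.FluidPDE.TaoLocalisationProofs
import HarnessLib

/-!
# Ladyzhenskaya's a-priori enstrophy bound for axisymmetric flows without swirl, WITH A FORCE

Analysis/FluidPDE proof file (all results proved, no definitions, no named facts): the FORCED
twin of `axisymmetricNoSwirl_enstrophy_apriori_holds` (`AxisymmetricNoSwirlAprioriProofs`;
Lemarié-Rieusset 2016, Thm. 10.4, proof pp. 285–289, printed with `f = 0`; Ladyzhenskaya 1968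
states her theorem for the Cauchy problem with an axisymmetric external force,
Zap. Naučn. Sem. LOMI 7 (1968) 155–177; Ukhovskii–Yudovich 1968).

**Theorem** (`axisymmetricNoSwirl_enstrophy_apriori_forced`). For all `ν > 0`, `T > 0` and
`E₀, G₀, H₀, P₁, P₂ ≥ 0` there is `K ≥ 0` such that for every `0 < T' ≤ T` and every classical
solution `(u, p)` of Navier–Stokes with force `f` on `[0, T'] × ℝ³` in the smooth class
`u ∈ L^∞_t H^k_x` (all `k`; `HasBoundedSobolevNormsOn`), with `u(t)` AND `f(t)` axisymmetric
without swirl at every time, slab energy `∫ |u(t)|² ≤ E₀`, data `∫ ‖Du(0)‖² ≤ G₀`,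
`∫ ‖D²u(0)‖² ≤ H₀`, and force `∫ ‖Df(t)‖² ≤ P₁`, `∫ ‖D²f(t)‖² ≤ P₂` on the slab, one has
`∫ ‖Du(t)‖² ≤ K` for all `t ∈ [0, T']`.

Proof = the unforced proof with two work terms:
1. uniform slab bounds from the smooth class (`AxisymNoSwirlTaoBounds`, class-agnostic; the sup
   bound from `linfty_bound_of_hasBoundedSobolevNormsOn_holds`);
2. Ladyzhenskaya's estimate WITH FORCE in data form (`ladyzhenskaya_weighted_bound_forced`):
   `‖q(t)‖₂² ≤ 2‖q(0)‖₂² + 4T²G₂ ≤ 6κ²H₀ + 12κ²T²P₂ =: F₀²` (`q = ω_θ/r`, `g = (curl f)_θ/r`,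
   `‖g‖₂² ≤ 3κ²‖D²f‖₂²`);
3. the forced enstrophy inequality (`enstrophy_integral_le_forced`) with the majorant
   `Φ = (ν/2)D + A' + M'Y`: the stretching part `(ν/2)D + A + MY` is the unforced
   `stretch_integral_le_majorant` (Sobolev `‖u‖_∞ ≤ K_S(√E₀ + √(K_dY) + √(K_dD))`, Young), the work
   part `∫ |ω| |curl f| ≤ (Y + ‖curl f‖₂²)/2 ≤ Y/2 + κ²P₁/2`; so `A' = A + κ²P₁/2`, `M' = M + 1/2`;
4. Grönwall (`gronwall_const_of_integral_le`) and the `div`–`curl` bound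
   (`tao2011_sobolev_of_vorticity_holds`): `K = K_d (κ²G₀ + 2A'T) e^{2M'T}`.

The slab energy bound is taken as a hypothesis (for forced solutions it is Tao's Lemma 8.1 with
force, a tree theorem the consumer already holds); symmetry of `u(t)`, `f(t)` at all times is a
hypothesis (its propagation from the data is `ForcedSymmetryPreservation`). WHAT THIS IS NOT:
not a statement about Navier–Stokes blow-up — a 1968 a-priori estimate in the forced setting;
the global-regularity corollary for Clay data and forces is assembled Summits-side.

## Mathlib / tree search

`lean search 'apriori.*forced|enstrophy_apriori_forced'`: nothing before this file. Reused by
import: `stretch_integral_le_majorant`, `gronwall_const_of_integral_le`,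
`integral_sq_norm_le_of_lintegral_le`, `toReal_ofReal_rpow_half` (`AxisymmetricNoSwirlAprioriProofs`),
`exists_forall_hadamardQuotFst_curl_le`, `integrable_norm_curl_sq`,
`integrable_frobeniusNormSq_fderiv_curl`, `integrable_hadamardQuotFst_curl_sq`,
`integrable_stretch_density` (`AxisymNoSwirlTaoBounds`), `aestronglyMeasurable_enstrophy`,
`aestronglyMeasurable_dissipation` (`AxisymNoSwirlEnstrophyIneq`),
`FunctionSpaces.exists_enorm_le_sobolev_two_two_dim_three`, `tao2011_sobolev_of_vorticity_holds`.

## References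

* P. G. Lemarié-Rieusset, *The Navier–Stokes Problem in the 21st Century*, CRC Press (2016),
  §10.3, Thm. 10.4 (p. 285) and its proof, pp. 285–289. [LemarieRieusset2016]
* O. A. Ladyzhenskaya, Zap. Naučn. Sem. LOMI 7 (1968) 155–177; M. R. Ukhovskii,
  V. I. Yudovich, J. Appl. Math. Mech. 32 (1968) 52–69; S. Leonardi, J. Málek, J. Nečas,
  M. Pokorný, Z. Anal. Anwendungen 18 (1999) 639–649.
* J. C. Robinson, J. L. Rodrigo, W. Sadowski, *The Three-Dimensional Navier–Stokes Equations*,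
  CUP 2016, Lemma A.25 (Grönwall). [RobinsonRodrigoSadowski2016]
-/

noncomputable section

open Set Function Filter MeasureTheory Metric Topology intervalIntegral
open scoped RealInnerProductSpace ENNReal NNReal Topology Interval

namespace Literature.Analysis.FluidPDE

section WorkDensity

variable {v w : EuclideanSpace ℝ (Fin 3) → EuclideanSpace ℝ (Fin 3)}

/-- The work density `|curl v| |curl w|` of two `C²` fields with square-integrable vorticities is
integrable, with `∫ |curl v| |curl w| ≤ ½ (∫ |curl v|² + ∫ |curl w|²)`. [folklore] -/
private theorem integrable_work_density (hv : ContDiff ℝ 2 v) (hw : ContDiff ℝ 2 w)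
    (hY : Integrable fun x => ‖curl v x‖ ^ 2) (hC : Integrable fun x => ‖curl w x‖ ^ 2) :
    Integrable (fun x => ‖curl v x‖ * ‖curl w x‖) ∧
      ∫ x, ‖curl v x‖ * ‖curl w x‖ ≤ 1 / 2 * ((∫ x, ‖curl v x‖ ^ 2) + ∫ x, ‖curl w x‖ ^ 2) := by
  have hvc : Continuous (curl v) := (contDiff_curl (n := 1) (by exact_mod_cast hv)).continuous
  have hwc : Continuous (curl w) := (contDiff_curl (n := 1) (by exact_mod_cast hw)).continuous
  have hsum : Integrable fun x => 1 / 2 * (‖curl v x‖ ^ 2 + ‖curl w x‖ ^ 2) :=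
    (hY.add hC).const_mul _
  have hpt : ∀ x, ‖curl v x‖ * ‖curl w x‖ ≤ 1 / 2 * (‖curl v x‖ ^ 2 + ‖curl w x‖ ^ 2) := by
    intro x
    have h := two_mul_le_add_sq ‖curl v x‖ ‖curl w x‖
    linarith
  have hI : Integrable fun x => ‖curl v x‖ * ‖curl w x‖ := by
    refine hsum.mono' (hvc.norm.mul hwc.norm).aestronglyMeasurable (ae_of_all _ fun x => ?_)
    rw [Real.norm_eq_abs, abs_of_nonneg (mul_nonneg (norm_nonneg _) (norm_nonneg _))]
    exact hpt x
  refine ⟨hI, ?_⟩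
  have step1 := integral_mono hI hsum hpt
  rw [MeasureTheory.integral_const_mul, integral_add hY hC] at step1
  exact step1

end WorkDensity

section SupBound

/-- **The Sobolev sup bound through the vorticity norms** (bookkeeping step of Lemarié-Rieusset
2016, p. 289: `‖u‖_∞ ≲ ‖u‖_{H²}` with `‖Du‖₂² ≤ K_d‖ω‖₂²`, `‖D²u‖₂² ≤ K_d‖∇ω‖₂²`): from the
imbedding `‖v(x)‖ₑ ≤ K Σ_{j<3} ‖Dʲv‖₂`, the energy bound `‖v‖₂ ≤ √E₀` and the `div`–`curl`
bounds, `|v(x)| ≤ K (√E₀ + √(K_d ∫|ω|²) + √(K_d ∫|∇ω|²_F))`. [folklore] -/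
private theorem norm_le_sobolev_vorticity {K : ℝ≥0∞} (hKtop : K < ⊤) {Kd : ℝ≥0} {E₀ : ℝ}
    (hE₀ : 0 ≤ E₀) {v : EuclideanSpace ℝ (Fin 3) → EuclideanSpace ℝ (Fin 3)}
    (hSv : ∀ x, ‖v x‖ₑ ≤ K * ∑ j ∈ Finset.range 3, eLpNorm (iteratedFDeriv ℝ j v) 2 volume)
    (henergy : eLpNorm v 2 volume ≤ (ENNReal.ofReal E₀) ^ (1 / 2 : ℝ))
    (hdc1 : ∫⁻ x, ‖iteratedFDeriv ℝ 1 v x‖ₑ ^ 2 ≤ Kd * ∫⁻ x, ‖curl v x‖ₑ ^ 2)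
    (hdc2 : ∫⁻ x, ‖iteratedFDeriv ℝ 2 v x‖ₑ ^ 2 ≤ Kd * ∫⁻ x, ‖fderiv ℝ (curl v) x‖ₑ ^ 2)
    (hYi : Integrable fun x => ‖curl v x‖ ^ 2)
    (hDi : Integrable fun x => frobeniusNormSq (fderiv ℝ (curl v) x)) :
    ∀ x, ‖v x‖ ≤ K.toReal * (Real.sqrt E₀ + Real.sqrt (Kd * ∫ y, ‖curl v y‖ ^ 2) +
      Real.sqrt (Kd * ∫ y, frobeniusNormSq (fderiv ℝ (curl v) y))) := by
  intro x
  have hKd0 : 0 ≤ (Kd : ℝ) := Kd.coe_nonneg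
  set q0 : ℝ≥0∞ := (ENNReal.ofReal E₀) ^ (1 / 2 : ℝ) with hq0
  set q1 : ℝ≥0∞ := (ENNReal.ofReal ((Kd : ℝ) * ∫ y, ‖curl v y‖ ^ 2)) ^ (1 / 2 : ℝ) with hq1
  set q2 : ℝ≥0∞ := (ENNReal.ofReal ((Kd : ℝ) * ∫ y, frobeniusNormSq (fderiv ℝ (curl v) y))) ^
    (1 / 2 : ℝ) with hq2
  have e0 : eLpNorm (iteratedFDeriv ℝ 0 v) 2 volume ≤ q0 := by
    have : eLpNorm (iteratedFDeriv ℝ 0 v) 2 volume = eLpNorm v 2 volume :=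
      eLpNorm_congr_norm_ae (ae_of_all _ fun y => by rw [norm_iteratedFDeriv_zero])
    rw [this]; exact henergy
  have hYlin : ∫⁻ y, ‖curl v y‖ₑ ^ 2 = ENNReal.ofReal (∫ y, ‖curl v y‖ ^ 2) := by
    rw [ofReal_integral_eq_lintegral_ofReal hYi (ae_of_all _ fun y => sq_nonneg _)]
    refine lintegral_congr fun y => ?_
    rw [← ofReal_norm, ENNReal.ofReal_pow (norm_nonneg _)]
  have hDlin : ∫⁻ y, ‖fderiv ℝ (curl v) y‖ₑ ^ 2 ≤
      ENNReal.ofReal (∫ y, frobeniusNormSq (fderiv ℝ (curl v) y)) := by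
    rw [ofReal_integral_eq_lintegral_ofReal hDi (ae_of_all _ fun y => frobeniusNormSq_nonneg _)]
    refine lintegral_mono fun y => ?_
    rw [← ofReal_norm, ← ENNReal.ofReal_pow (norm_nonneg _)]
    exact ENNReal.ofReal_le_ofReal (sq_opNorm_le_frobeniusNormSq _)
  have e1 : eLpNorm (iteratedFDeriv ℝ 1 v) 2 volume ≤ q1 := by
    refine eLpNorm_two_le_rpow_of_lintegral_sq_le (hdc1.trans ?_)
    rw [hYlin, ENNReal.ofReal_mul hKd0, ENNReal.ofReal_coe_nnreal]
  have e2 : eLpNorm (iteratedFDeriv ℝ 2 v) 2 volume ≤ q2 := by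
    refine eLpNorm_two_le_rpow_of_lintegral_sq_le (hdc2.trans ?_)
    rw [ENNReal.ofReal_mul hKd0, ENNReal.ofReal_coe_nnreal]
    exact mul_le_mul_right hDlin _
  have hq0t : q0 ≠ ⊤ := ENNReal.rpow_ne_top_of_nonneg (by norm_num) ENNReal.ofReal_ne_top
  have hq1t : q1 ≠ ⊤ := ENNReal.rpow_ne_top_of_nonneg (by norm_num) ENNReal.ofReal_ne_top
  have hq2t : q2 ≠ ⊤ := ENNReal.rpow_ne_top_of_nonneg (by norm_num) ENNReal.ofReal_ne_top
  have hen : ‖v x‖ₑ ≤ K * (q0 + q1 + q2) := by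
    refine (hSv x).trans ?_
    rw [Finset.sum_range_succ, Finset.sum_range_succ, Finset.sum_range_one]
    gcongr
  have hRt : K * (q0 + q1 + q2) ≠ ⊤ :=
    ENNReal.mul_ne_top hKtop.ne (by simp [hq0t, hq1t, hq2t])
  have hY0' : 0 ≤ ∫ y, ‖curl v y‖ ^ 2 := integral_nonneg fun y => sq_nonneg _
  have hD0' : 0 ≤ ∫ y, frobeniusNormSq (fderiv ℝ (curl v) y) :=
    integral_nonneg fun y => frobeniusNormSq_nonneg _
  calc ‖v x‖ = (‖v x‖ₑ).toReal := (toReal_enorm _).symm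
    _ ≤ (K * (q0 + q1 + q2)).toReal := ENNReal.toReal_mono hRt hen
    _ = K.toReal * (Real.sqrt E₀ + Real.sqrt (Kd * ∫ y, ‖curl v y‖ ^ 2) +
        Real.sqrt (Kd * ∫ y, frobeniusNormSq (fderiv ℝ (curl v) y))) := by
        rw [ENNReal.toReal_mul, ENNReal.toReal_add (by simp [hq0t, hq1t]) hq2t,
          ENNReal.toReal_add hq0t hq1t, hq0, hq1, hq2, toReal_ofReal_rpow_half hE₀,
          toReal_ofReal_rpow_half (mul_nonneg hKd0 hY0'),
          toReal_ofReal_rpow_half (mul_nonneg hKd0 hD0')]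

end SupBound

section Main

/-- **Ladyzhenskaya's a-priori enstrophy bound for axisymmetric Navier–Stokes flows without
swirl, WITH an axisymmetric swirl-free force** (Lemarié-Rieusset 2016, Thm. 10.4, proof
pp. 285–289, printed with `f = 0`; Ladyzhenskaya 1968 with force; Ukhovskii–Yudovich 1968).
For all `ν > 0`, `T > 0`, `E₀, G₀, H₀, P₁, P₂ ≥ 0` there is `K ≥ 0` such that: for every
`0 < T' ≤ T` and every classical solution `(u, p)` of the Navier–Stokes system with force `f` on
`[0, T'] × ℝ³` with all spatial Sobolev norms of `u` bounded on the slab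
(`HasBoundedSobolevNormsOn`), `u(t)` and `f(t)` axisymmetric without swirl for all
`t ∈ [0, T']`, slab energy `∫ |u(t)|² ≤ E₀`, `∫ ‖Du(0)‖² ≤ G₀`, `∫ ‖D²u(0)‖² ≤ H₀`,
`∫ ‖Df(t)‖² ≤ P₁` and `∫ ‖D²f(t)‖² ≤ P₂` on the slab (operator norms of Fréchet derivatives),
one has `∫ ‖Du(t)‖² ≤ K` for all `t ∈ [0, T']`. The constant is
`K = K_d (κ²G₀ + 2A'T) exp(2M'T)` with `F₀² = 6κ²H₀ + 12κ²T²P₂`, `A = K_S F₀ √E₀/2`,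
`M = A + K_S F₀ √K_d + (K_S F₀ √K_d)²/(2ν)`, `A' = A + κ²P₁/2`, `M' = M + 1/2`, `κ = ‖curlCLM‖`,
`K_S` the Sobolev constant, `K_d` the `div`–`curl` constant. [cite: LemarieRieusset2016, Thm. 10.4 (p. 285), proof pp. 286–289] -/
theorem axisymmetricNoSwirl_enstrophy_apriori_forced :
    ∀ ⦃ν T E₀ G₀ H₀ P₁ P₂ : ℝ⦄, 0 < ν → 0 < T → 0 ≤ E₀ → 0 ≤ G₀ → 0 ≤ H₀ → 0 ≤ P₁ → 0 ≤ P₂ →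
    ∃ K : ℝ, 0 ≤ K ∧ ∀ ⦃T' : ℝ⦄, 0 < T' → T' ≤ T →
      ∀ ⦃f u : ℝ → EuclideanSpace ℝ (Fin 3) → EuclideanSpace ℝ (Fin 3)⦄
        ⦃p : ℝ → EuclideanSpace ℝ (Fin 3) → ℝ⦄,
        IsClassicalNSSolutionOn (Icc 0 T') ν f u p →
        HasBoundedSobolevNormsOn (Icc 0 T') u →
        (∀ t ∈ Icc 0 T', IsAxisymmetric (u t)) → (∀ t ∈ Icc 0 T', HasNoSwirl (u t)) →
        (∀ t ∈ Icc 0 T', IsAxisymmetric (f t)) → (∀ t ∈ Icc 0 T', HasNoSwirl (f t)) →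
        (∀ t ∈ Icc 0 T', ∫⁻ x, ‖u t x‖ₑ ^ 2 ≤ ENNReal.ofReal E₀) →
        ∫⁻ x, ‖iteratedFDeriv ℝ 1 (u 0) x‖ₑ ^ 2 ≤ ENNReal.ofReal G₀ →
        ∫⁻ x, ‖iteratedFDeriv ℝ 2 (u 0) x‖ₑ ^ 2 ≤ ENNReal.ofReal H₀ →
        (∀ t ∈ Icc 0 T', ∫⁻ x, ‖iteratedFDeriv ℝ 1 (f t) x‖ₑ ^ 2 ≤ ENNReal.ofReal P₁) →
        (∀ t ∈ Icc 0 T', ∫⁻ x, ‖iteratedFDeriv ℝ 2 (f t) x‖ₑ ^ 2 ≤ ENNReal.ofReal P₂) →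
        ∀ t ∈ Icc 0 T', ∫⁻ x, ‖iteratedFDeriv ℝ 1 (u t) x‖ₑ ^ 2 ≤ ENNReal.ofReal K := by
  intro ν T E₀ G₀ H₀ P₁ P₂ hν hT hE₀ hG₀ hH₀ hP₁ hP₂
  -- universal constants
  obtain ⟨K, hKtop, hS⟩ := FunctionSpaces.exists_enorm_le_sobolev_two_two_dim_three
    (E := EuclideanSpace ℝ (Fin 3)) (F := EuclideanSpace ℝ (Fin 3))
    (volume : Measure (EuclideanSpace ℝ (Fin 3))) finrank_euclideanSpace_fin
  obtain ⟨Kd, hKd⟩ := tao2011_sobolev_of_vorticity_holds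
  set KS : ℝ := K.toReal with hKS
  set κ : ℝ := ‖curlCLM‖ with hκ
  set F₀sq : ℝ := 6 * κ ^ 2 * H₀ + 12 * κ ^ 2 * T ^ 2 * P₂ with hF₀sq
  set A : ℝ := KS * Real.sqrt F₀sq * Real.sqrt E₀ / 2 with hA
  set M : ℝ := KS * Real.sqrt F₀sq * Real.sqrt E₀ / 2 + KS * Real.sqrt F₀sq * Real.sqrt Kd +
    (KS * Real.sqrt F₀sq * Real.sqrt Kd) ^ 2 / (2 * ν) with hM
  set A' : ℝ := A + κ ^ 2 * P₁ / 2 with hA'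
  set M' : ℝ := M + 1 / 2 with hM'
  have hKS0 : 0 ≤ KS := ENNReal.toReal_nonneg
  have hKd0 : 0 ≤ (Kd : ℝ) := Kd.coe_nonneg
  have hκ0 : 0 ≤ κ := by rw [hκ]; exact norm_nonneg curlCLM
  have hκ2 : 0 ≤ κ ^ 2 := sq_nonneg κ
  have hF₀sq0 : 0 ≤ F₀sq := by
    have h1 : 0 ≤ 6 * κ ^ 2 * H₀ := mul_nonneg (mul_nonneg (by norm_num) hκ2) hH₀
    have h2 : 0 ≤ 12 * κ ^ 2 * T ^ 2 * P₂ :=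
      mul_nonneg (mul_nonneg (mul_nonneg (by norm_num) hκ2) (sq_nonneg T)) hP₂
    exact add_nonneg h1 h2
  have hsF : 0 ≤ Real.sqrt F₀sq := Real.sqrt_nonneg _
  have hA0 : 0 ≤ A :=
    div_nonneg (mul_nonneg (mul_nonneg hKS0 hsF) (Real.sqrt_nonneg _)) zero_le_two
  have hM0 : 0 ≤ M :=
    add_nonneg (add_nonneg hA0 (mul_nonneg (mul_nonneg hKS0 hsF) (Real.sqrt_nonneg _)))
      (div_nonneg (sq_nonneg _) (mul_nonneg zero_le_two hν.le))
  have hA'0 : 0 ≤ A' := add_nonneg hA0 (div_nonneg (mul_nonneg hκ2 hP₁) (by norm_num))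
  have hM'0 : 0 ≤ M' := add_nonneg hM0 (by norm_num)
  refine ⟨(Kd : ℝ) * (κ ^ 2 * G₀ + 2 * A' * T) * Real.exp (2 * M' * T),
    mul_nonneg (mul_nonneg hKd0 (add_nonneg (mul_nonneg hκ2 hG₀)
      (mul_nonneg (mul_nonneg zero_le_two hA'0) hT.le))) (Real.exp_pos _).le, ?_⟩
  intro T' hT' hT'T f u p hsol hH hax hsw hfax hfsw hE hG hH2 hfP₁ hfP₂ t ht
  have hν0 : 0 ≤ ν := hν.le
  have hU : UniqueDiffOn ℝ (Icc 0 T') := uniqueDiffOn_Icc hT'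
  have h0T : (0 : ℝ) ∈ Icc 0 T' := ⟨le_rfl, hT'.le⟩
  have hsm : ∀ s ∈ Icc 0 T', ContDiff ℝ ((⊤ : ℕ∞) : WithTop ℕ∞) (u s) := fun s hs =>
    hsol.contDiff_velocity hs
  have hsm5 : ∀ s ∈ Icc 0 T', ContDiff ℝ 5 (u s) := fun s hs => (hsm s hs).of_le (by norm_cast)
  have hsm3 : ∀ s ∈ Icc 0 T', ContDiff ℝ 3 (u s) := fun s hs => (hsm s hs).of_le (by norm_cast)
  have hsm2 : ∀ s ∈ Icc 0 T', ContDiff ℝ 2 (u s) := fun s hs => (hsm s hs).of_le (by norm_cast)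
  -- the force slices are smooth
  have hfsm : ∀ s ∈ Icc 0 T', ContDiff ℝ ((⊤ : ℕ∞) : WithTop ℕ∞) (f s) := fun s hs =>
    (hsol.isSmoothSpaceTimeOn_force hU).contDiff_slice hs
  have hfsm3 : ∀ s ∈ Icc 0 T', ContDiff ℝ 3 (f s) := fun s hs => (hfsm s hs).of_le (by norm_cast)
  have hfsm2 : ∀ s ∈ Icc 0 T', ContDiff ℝ 2 (f s) := fun s hs => (hfsm s hs).of_le (by norm_cast)
  -- uniform slab bounds
  obtain ⟨V₀, hV₀⟩ := linfty_bound_of_hasBoundedSobolevNormsOn_holds hsm2 hH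
  set V : ℝ := max V₀ 0 with hVdef
  have hV0 : 0 ≤ V := le_max_right _ _
  have hV : ∀ s ∈ Icc 0 T', ∀ x, ‖u s x‖ ≤ V := fun s hs x => (hV₀ s hs x).trans (le_max_left _ _)
  obtain ⟨F, G, hFG⟩ := exists_forall_hadamardQuotFst_curl_le hsm5 hH
  obtain ⟨C₁, hC₁⟩ := hH 1
  obtain ⟨C₂, hC₂⟩ := hH 2
  have hfin1 : ∀ s ∈ Icc 0 T', ∫⁻ x, ‖iteratedFDeriv ℝ 1 (u s) x‖ₑ ^ 2 < ⊤ := fun s hs =>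
    lt_of_le_of_lt (hC₁ s hs) ENNReal.coe_lt_top
  have hfin2 : ∀ s ∈ Icc 0 T', ∫⁻ x, ‖iteratedFDeriv ℝ 2 (u s) x‖ₑ ^ 2 < ⊤ := fun s hs =>
    lt_of_le_of_lt (hC₂ s hs) ENNReal.coe_lt_top
  have hffin1 : ∀ s ∈ Icc 0 T', ∫⁻ x, ‖iteratedFDeriv ℝ 1 (f s) x‖ₑ ^ 2 < ⊤ := fun s hs =>
    lt_of_le_of_lt (hfP₁ s hs) ENNReal.ofReal_lt_top
  have hffin2 : ∀ s ∈ Icc 0 T', ∫⁻ x, ‖iteratedFDeriv ℝ 2 (f s) x‖ₑ ^ 2 < ⊤ := fun s hs =>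
    lt_of_le_of_lt (hfP₂ s hs) ENNReal.ofReal_lt_top
  have hYs : ∀ s ∈ Icc 0 T', Integrable (fun x => ‖curl (u s) x‖ ^ 2) ∧
      ∫ x, ‖curl (u s) x‖ ^ 2 ≤ κ ^ 2 * (C₁ : ℝ) := fun s hs => by
    obtain ⟨hi, hle⟩ := integrable_norm_curl_sq (hsm2 s hs) (hfin1 s hs)
    rw [← hκ] at hle
    refine ⟨hi, hle.trans (mul_le_mul_of_nonneg_left ?_
      hκ2)⟩
    exact ENNReal.toReal_le_coe_of_le_coe (hC₁ s hs)
  have hDs : ∀ s ∈ Icc 0 T', Integrable (fun x => frobeniusNormSq (fderiv ℝ (curl (u s)) x)) ∧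
      ∫ x, frobeniusNormSq (fderiv ℝ (curl (u s)) x) ≤ 3 * κ ^ 2 * (C₂ : ℝ) := fun s hs => by
    obtain ⟨hi, hle⟩ := integrable_frobeniusNormSq_fderiv_curl (hsm3 s hs) (hfin2 s hs)
    rw [← hκ] at hle
    refine ⟨hi, hle.trans (mul_le_mul_of_nonneg_left ?_
      (mul_nonneg (by norm_num) hκ2))⟩
    exact ENNReal.toReal_le_coe_of_le_coe (hC₂ s hs)
  have hfs : ∀ s ∈ Icc 0 T', Integrable (fun x => hadamardQuotFst (fun y => curl (u s) y 1) x ^ 2) ∧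
      ∫ x, hadamardQuotFst (fun y => curl (u s) y 1) x ^ 2 ≤ 3 * κ ^ 2 * (C₂ : ℝ) := fun s hs => by
    obtain ⟨hi, hle⟩ := integrable_hadamardQuotFst_curl_sq (hsm3 s hs) (hax s hs) (hsw s hs)
      (hfin2 s hs)
    rw [← hκ] at hle
    refine ⟨hi, hle.trans (mul_le_mul_of_nonneg_left ?_
      (mul_nonneg (by norm_num) hκ2))⟩
    exact ENNReal.toReal_le_coe_of_le_coe (hC₂ s hs)
  have hSis : ∀ s ∈ Icc 0 T', Integrable fun x =>
      |hadamardQuotFst (fun y => curl (u s) y 1) x| * ‖curl (u s) x‖ * ‖u s x‖ := fun s hs =>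
    integrable_stretch_density (hsm3 s hs) (hV s hs) (hfs s hs).1 (hYs s hs).1
  -- energy: `‖u(s)‖₂ ≤ √E₀`
  have henergy : ∀ s ∈ Icc 0 T', eLpNorm (u s) 2 volume ≤ (ENNReal.ofReal E₀) ^ (1 / 2 : ℝ) :=
    fun s hs => eLpNorm_two_le_rpow_of_lintegral_sq_le (hE s hs)
  -- Sobolev: `|u(s, x)| ≤ K_S (√E₀ + √(K_d Y(s)) + √(K_d D(s)))`
  have hsup : ∀ s ∈ Icc 0 T', ∀ x, ‖u s x‖ ≤ KS * (Real.sqrt E₀ +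
      Real.sqrt (Kd * ∫ y, ‖curl (u s) y‖ ^ 2) +
      Real.sqrt (Kd * ∫ y, frobeniusNormSq (fderiv ℝ (curl (u s)) y))) := by
    intro s hs
    have hL2 : ∫⁻ y, ‖u s y‖ₑ ^ 2 < ⊤ := lt_of_le_of_lt (hE s hs) ENNReal.ofReal_lt_top
    obtain ⟨hdc1, hdc2⟩ := hKd (hsm s hs) (hsol.divFree s hs) hL2
    exact norm_le_sobolev_vorticity hKtop hE₀ (hS (u s) (hsm2 s hs)) (henergy s hs) hdc1 hdc2
      (hYs s hs).1 (hDs s hs).1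
  -- the force's vorticity: `∫ |curl f(s)|² ≤ κ²P₁`, and its quotient `∫ g(s)² ≤ 3κ²P₂`
  have hcfs : ∀ s ∈ Icc 0 T', Integrable (fun x => ‖curl (f s) x‖ ^ 2) ∧
      ∫ x, ‖curl (f s) x‖ ^ 2 ≤ κ ^ 2 * P₁ := fun s hs => by
    obtain ⟨hi, hle⟩ := integrable_norm_curl_sq (hfsm2 s hs) (hffin1 s hs)
    rw [← hκ] at hle
    refine ⟨hi, hle.trans (mul_le_mul_of_nonneg_left ?_
      hκ2)⟩
    exact ENNReal.toReal_le_of_le_ofReal hP₁ (hfP₁ s hs)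
  have hgs : ∀ s ∈ Icc 0 T', Integrable (fun x => hadamardQuotFst (fun y => curl (f s) y 1) x ^ 2) ∧
      ∫ x, hadamardQuotFst (fun y => curl (f s) y 1) x ^ 2 ≤ 3 * κ ^ 2 * P₂ := fun s hs => by
    obtain ⟨hi, hle⟩ := integrable_hadamardQuotFst_curl_sq (hfsm3 s hs) (hfax s hs) (hfsw s hs)
      (hffin2 s hs)
    rw [← hκ] at hle
    refine ⟨hi, hle.trans (mul_le_mul_of_nonneg_left ?_
      (mul_nonneg (by norm_num) hκ2))⟩
    exact ENNReal.toReal_le_of_le_ofReal hP₂ (hfP₂ s hs)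
  -- the work density `|ω| |curl f|` is integrable, with `∫ |ω||curl f| ≤ (Y + κ²P₁)/2`
  have hWs : ∀ s ∈ Icc 0 T', Integrable (fun x => ‖curl (u s) x‖ * ‖curl (f s) x‖) ∧
      ∫ x, ‖curl (u s) x‖ * ‖curl (f s) x‖ ≤
        1 / 2 * ((∫ x, ‖curl (u s) x‖ ^ 2) + κ ^ 2 * P₁) := fun s hs => by
    obtain ⟨hI, hle⟩ := integrable_work_density (hsm2 s hs) (hfsm2 s hs) (hYs s hs).1 (hcfs s hs).1
    refine ⟨hI, hle.trans ?_⟩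
    have h2 := add_le_add (le_refl (∫ x, ‖curl (u s) x‖ ^ 2)) (hcfs s hs).2
    exact mul_le_mul_of_nonneg_left h2 (by norm_num)
  -- Ladyzhenskaya's estimate with force, data form: `∫ q(s)² ≤ 2∫q(0)² + 4T'²(3κ²P₂) ≤ F₀²`
  have hq0 : ∫ x, hadamardQuotFst (fun y => curl (u 0) y 1) x ^ 2 ≤ 3 * κ ^ 2 * H₀ := by
    obtain ⟨-, hle⟩ := integrable_hadamardQuotFst_curl_sq (hsm3 0 h0T) (hax 0 h0T) (hsw 0 h0T)
      (hfin2 0 h0T)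
    rw [← hκ] at hle
    refine hle.trans ?_
    have h2 : (∫⁻ x, ‖iteratedFDeriv ℝ 2 (u 0) x‖ₑ ^ 2).toReal ≤ H₀ :=
      ENNReal.toReal_le_of_le_ofReal hH₀ hH2
    have h3 : 0 ≤ 3 * κ ^ 2 := mul_nonneg (by norm_num) (sq_nonneg κ)
    exact mul_le_mul_of_nonneg_left h2 h3
  have hLady : ∀ s ∈ Icc 0 T', ∫ x, hadamardQuotFst (fun y => curl (u s) y 1) x ^ 2 ≤ F₀sq := by
    intro s hs
    have h := ladyzhenskaya_weighted_bound_forced hT' hν0 hsol hax hsw hfax hfsw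
      (fun τ hτ x => (hFG τ hτ x).1) (fun τ hτ x => (hFG τ hτ x).2) hV
      (fun τ hτ => (hfs τ hτ).1) (fun τ hτ => (hfs τ hτ).2) (fun τ hτ => (hgs τ hτ).1)
      (fun τ hτ => (hgs τ hτ).2) s hs
    refine h.trans ?_
    have hT2 : T' ^ 2 ≤ T ^ 2 := pow_le_pow_left₀ hT'.le hT'T 2
    have h3 : 0 ≤ 3 * κ ^ 2 * P₂ := mul_nonneg (mul_nonneg (by norm_num) (sq_nonneg κ)) hP₂
    have h4 : T' ^ 2 * (3 * κ ^ 2 * P₂) ≤ T ^ 2 * (3 * κ ^ 2 * P₂) :=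
      mul_le_mul_of_nonneg_right hT2 h3
    have h5 : 2 * (∫ x, hadamardQuotFst (fun y => curl (u 0) y 1) x ^ 2) +
        4 * T' ^ 2 * (3 * κ ^ 2 * P₂) ≤ 6 * κ ^ 2 * H₀ + 12 * κ ^ 2 * T ^ 2 * P₂ := by
      linarith [hq0, h4]
    exact h5.trans_eq hF₀sq.symm
  -- names for the enstrophy and the dissipation as functions of time
  obtain ⟨Yf, hYf⟩ : ∃ Yf : ℝ → ℝ, ∀ s, Yf s = ∫ x, ‖curl (u s) x‖ ^ 2 := ⟨_, fun s => rfl⟩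
  obtain ⟨Df, hDf⟩ : ∃ Df : ℝ → ℝ, ∀ s, Df s = ∫ x, frobeniusNormSq (fderiv ℝ (curl (u s)) x) :=
    ⟨_, fun s => rfl⟩
  have hYfun : Yf = fun s => ∫ x, ‖curl (u s) x‖ ^ 2 := funext hYf
  have hDfun : Df = fun s => ∫ x, frobeniusNormSq (fderiv ℝ (curl (u s)) x) := funext hDf
  have hYnn : ∀ s, 0 ≤ Yf s := fun s => by rw [hYf]; exact integral_nonneg fun x => sq_nonneg _
  have hDnn' : ∀ s, 0 ≤ Df s := fun s => by
    rw [hDf]; exact integral_nonneg fun x => frobeniusNormSq_nonneg _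
  have hYbd : ∀ s ∈ Icc 0 T', Yf s ≤ κ ^ 2 * (C₁ : ℝ) := fun s hs => by rw [hYf]; exact (hYs s hs).2
  have hDbd : ∀ s ∈ Icc 0 T', Df s ≤ 3 * κ ^ 2 * (C₂ : ℝ) := fun s hs => by
    rw [hDf]; exact (hDs s hs).2
  -- the majorant `Φ` (stretching + work)
  set Φ : ℝ → ℝ := fun s => ν / 2 * Df s + A' + M' * Yf s with hΦ
  have hΦle : ∀ s ∈ Icc 0 T',
      (∫ x, |hadamardQuotFst (fun y => curl (u s) y 1) x| * ‖curl (u s) x‖ * ‖u s x‖) +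
        (∫ x, ‖curl (u s) x‖ * ‖curl (f s) x‖) ≤ Φ s :=
    fun s hs => by
    have h := stretch_integral_le_majorant hν hKS0 hKd0 (hsm3 s hs)
      (hsup s hs) (hYs s hs).1 (hfs s hs).1 (hLady s hs) (hSis s hs)
    have hw := (hWs s hs).2
    simp only [hΦ, hA', hM', hA, hM, hYf, hDf]
    linarith [h, hw]
  have hYm : AEStronglyMeasurable Yf (volume.restrict (Icc 0 T')) := by
    rw [hYfun]
    exact aestronglyMeasurable_enstrophy hT' hsol.smooth_velocity (fun s hs => (hYs s hs).1)
  have hDm : AEStronglyMeasurable Df (volume.restrict (Icc 0 T')) := by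
    rw [hDfun]
    exact aestronglyMeasurable_dissipation hT' hsol.smooth_velocity (fun s hs => (hDs s hs).1)
  have hvolT : volume (Icc (0 : ℝ) T') < ⊤ := by simp
  have hYint : IntegrableOn Yf (Icc 0 T') :=
    ⟨hYm, HasFiniteIntegral.restrict_of_bounded (κ ^ 2 * (C₁ : ℝ)) hvolT
      ((ae_restrict_iff' measurableSet_Icc).2 (ae_of_all _ fun s hs => by
        rw [Real.norm_eq_abs, abs_of_nonneg (hYnn s)]; exact hYbd s hs))⟩
  have hDint : IntegrableOn Df (Icc 0 T') :=
    ⟨hDm, HasFiniteIntegral.restrict_of_bounded (3 * κ ^ 2 * (C₂ : ℝ)) hvolT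
      ((ae_restrict_iff' measurableSet_Icc).2 (ae_of_all _ fun s hs => by
        rw [Real.norm_eq_abs, abs_of_nonneg (hDnn' s)]; exact hDbd s hs))⟩
  have hΦint : IntegrableOn Φ (Icc 0 T') :=
    ((hDint.const_mul (ν / 2)).add (integrableOn_const hvolT.ne)).add (hYint.const_mul M')
  -- the forced enstrophy inequality, for every `τ ∈ [0, T']`
  have hmain : ∀ τ ∈ Icc 0 T', Yf τ ≤ (Yf 0 + 2 * A' * T') + 2 * M' * ∫ s in (0 : ℝ)..τ, Yf s := by
    intro τ hτ
    have h := enstrophy_integral_le_forced hT' hν0 hsol hax hsw hV (fun s hs => (hYs s hs).1)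
      (fun s hs => (hYs s hs).2) (fun s hs => (hDs s hs).1) (fun s hs => (hDs s hs).2) hSis
      (fun s hs => (hWs s hs).1) hΦint hΦle hτ
    rw [← hYf, ← hYf] at h
    have hD' : (fun s => ∫ x, frobeniusNormSq (fderiv ℝ (curl (u s)) x)) = Df := hDfun.symm
    rw [hD'] at h
    have hτT : Icc 0 τ ⊆ Icc 0 T' := Icc_subset_Icc le_rfl hτ.2
    have iD : IntervalIntegrable Df volume 0 τ :=
      (intervalIntegrable_iff_integrableOn_Icc_of_le hτ.1).2 (hDint.mono_set hτT)
    have iY : IntervalIntegrable Yf volume 0 τ :=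
      (intervalIntegrable_iff_integrableOn_Icc_of_le hτ.1).2 (hYint.mono_set hτT)
    have i1 : IntervalIntegrable (fun s => ν / 2 * Df s) volume 0 τ := iD.const_mul _
    have i12 : IntervalIntegrable (fun s => ν / 2 * Df s + A') volume 0 τ :=
      i1.add intervalIntegrable_const
    have i3 : IntervalIntegrable (fun s => M' * Yf s) volume 0 τ := iY.const_mul _
    have hsplit : ∫ s in (0 : ℝ)..τ, Φ s =
        ν / 2 * (∫ s in (0 : ℝ)..τ, Df s) + A' * τ + M' * ∫ s in (0 : ℝ)..τ, Yf s := by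
      rw [hΦ, intervalIntegral.integral_add i12 i3, intervalIntegral.integral_add i1
        intervalIntegrable_const, intervalIntegral.integral_const_mul,
        intervalIntegral.integral_const_mul, intervalIntegral.integral_const]
      simp only [sub_zero, smul_eq_mul]
      ring
    have hDnn : 0 ≤ ∫ s in (0 : ℝ)..τ, Df s :=
      intervalIntegral.integral_nonneg hτ.1 fun s _ => hDnn' s
    have hAτ : A' * τ ≤ A' * T' := mul_le_mul_of_nonneg_left hτ.2 hA'0
    rw [hsplit] at h
    have hνD : 0 ≤ ν * ∫ s in (0 : ℝ)..τ, Df s := mul_nonneg hν0 hDnn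
    linarith only [h, hνD, hAτ]
  -- Grönwall
  have hB0 : 0 ≤ Yf 0 + 2 * A' * T' := by
    have h1 := hYnn 0
    have h2 : 0 ≤ 2 * A' * T' := mul_nonneg (mul_nonneg zero_le_two hA'0) hT'.le
    linarith only [h1, h2]
  have hgr := gronwall_const_of_integral_le hT' hB0 hM'0 (fun τ _ => hYnn τ) hYbd hYint
    hmain t ht
  -- initial enstrophy `≤ κ² G₀`
  have hY0le : Yf 0 ≤ κ ^ 2 * G₀ := by
    obtain ⟨-, hle⟩ := integrable_norm_curl_sq (hsm2 0 h0T) (hfin1 0 h0T)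
    rw [← hκ] at hle
    rw [hYf]
    refine hle.trans (mul_le_mul_of_nonneg_left ?_ hκ2)
    exact ENNReal.toReal_le_of_le_ofReal hG₀ hG
  have hYt : Yf t ≤ (κ ^ 2 * G₀ + 2 * A' * T) * Real.exp (2 * M' * T) := by
    refine hgr.trans ?_
    have hAT : 2 * A' * T' ≤ 2 * A' * T := mul_le_mul_of_nonneg_left hT'T (mul_nonneg zero_le_two hA'0)
    have h1 : Yf 0 + 2 * A' * T' ≤ κ ^ 2 * G₀ + 2 * A' * T := by linarith only [hY0le, hAT]
    have h2 : Real.exp (2 * M' * t) ≤ Real.exp (2 * M' * T) :=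
      Real.exp_le_exp.2 (mul_le_mul_of_nonneg_left (ht.2.trans hT'T) (mul_nonneg zero_le_two hM'0))
    exact mul_le_mul h1 h2 (Real.exp_pos _).le
      (add_nonneg (mul_nonneg hκ2 hG₀) (mul_nonneg (mul_nonneg zero_le_two hA'0) hT.le))
  -- back to `Du(t)` through the `div`–`curl` bound
  have hL2t : ∫⁻ y, ‖u t y‖ₑ ^ 2 < ⊤ := lt_of_le_of_lt (hE t ht) ENNReal.ofReal_lt_top
  obtain ⟨hdc1, -⟩ := hKd (hsm t ht) (hsol.divFree t ht) hL2t
  have hYlin : ∫⁻ y, ‖curl (u t) y‖ₑ ^ 2 = ENNReal.ofReal (Yf t) := by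
    rw [hYf, ofReal_integral_eq_lintegral_ofReal (hYs t ht).1 (ae_of_all _ fun y => sq_nonneg _)]
    refine lintegral_congr fun y => ?_
    rw [← ofReal_norm, ENNReal.ofReal_pow (norm_nonneg _)]
  calc ∫⁻ x, ‖iteratedFDeriv ℝ 1 (u t) x‖ₑ ^ 2 ≤ Kd * ∫⁻ y, ‖curl (u t) y‖ₑ ^ 2 := hdc1
    _ = ENNReal.ofReal ((Kd : ℝ) * Yf t) := by
        rw [hYlin, ENNReal.ofReal_mul hKd0, ENNReal.ofReal_coe_nnreal]
    _ ≤ ENNReal.ofReal ((Kd : ℝ) * (κ ^ 2 * G₀ + 2 * A' * T) * Real.exp (2 * M' * T)) := by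
        refine ENNReal.ofReal_le_ofReal ?_
        rw [mul_assoc]
        exact mul_le_mul_of_nonneg_left hYt hKd0

end Main

end Literature.Analysis.FluidPDE

end
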